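/-
HONEST FRAMING: certified error envelopes and provably optimal rounding/accumulation schemes for
low-precision formats under stated cost models; every table by two implementations; no hardware
or vendor claims.
-/
import Summits.Ventures.CertifiedArithmetic.LowPrec.OptDemotionRoutingE3Opt
import Summits.Ventures.CertifiedArithmetic.LowPrec.OptDemotionRoutingPhi3p
import Summits.Ventures.CertifiedArithmetic.LowPrec.OptDemotionRoutingR33

/-!
# The demotion law (Theorem T8), part 10l: the POPCOUNT-3 top-level `E`-rows `E3(j,k,l)` — FOR EVERY `q`

  `x_(j-1,k-1,l-1) ≤ (1-u) x_(j,k,l) + (1+u) t x_(k-j,l-j,q-j)`,  `t = 2^-j`, `2 ≤ j < k < l ≤ q-1`,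

the e-side split target `(E_u)(β = ½, B = 2^-j + 2^-k + 2^-l)`, for EVERY tree and every `q ≥ 5`
(`treeBR_eRow3`).  Tree induction over the four-bit left side (part 10l-0 `treeBR_quad_node_le`,
sixteen options); EVERY branch is an instance of one of the four R33 branch lemmas of part 10j-a
with renamed coordinates (lean seat gen 14, CONJECTURE-D-NODESTEP.md §G14.2): `{all}` = IH
(`eRow2_branch4`); `∅` = opt's L1 pattern with (MC) at the four-bit configuration
(`eRow2_branch1`); `{j-1}` = R31(j) on `a` + the TWO-BIT LEMMA B1 on `b` (`eRow2_branch2`, rows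
10k-a′ `treeBR_gcB1_triple`, 10i-0 `two_treeBR_triple_le`); `{k-1}`, `{l-1}` = LEMMA Φ3(j,k) resp.
Φ3(j,l) on `a` + (MC) at a triple on `b` (`eRow2_branch3`); `{j-1,k-1}`, `{j-1,l-1}` = R33
(`treeBR_eRow2`) at `(j,k)` resp. `(j,l)` on `a` + LEMMA B1 on `b` (`eRow2_branch2`);
`{k-1,l-1}` = LEMMA Φ3′ (part 10k-b `treeBR_phi3p`) on `a` + (MC) on `b` (`eRow2_branch3`).
Exact cross-check of the sixteen certificates for all `(q,j,k,l)`, `q ≤ 18` (2380 quadruples,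
0 failures): sessions work/r33/cert_e3.py.  With parts 10c/10e/10j: every top-level e-side row of
opt's split with `popcount(B) ≤ 3` holds at `ρ = u` for every tree and every `q`.
-/

namespace Summit.Ventures.CertifiedArithmetic.LowPrec.Opt

open Literature.ComputerArithmetic.JeannerodRump2018
open Literature.ComputerArithmetic.JeannerodRump2018.SumTree

section E3

variable {q : ℕ}

/-- **THE POPCOUNT-3 TOP-LEVEL `E`-ROWS FOR EVERY `q`**: for `q ≥ 5`, `2 ≤ j < k < l ≤ q-1` and every
tree, `BR_t{0,-(j-1),-(k-1),-(l-1)} ≤ (1-u) BR_t{0,-j,-k,-l} + (1+u) 2^-j BR_t{0,-(k-j),-(l-j),-(q-j)}`. -/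
theorem treeBR_eRow3 (hq : 5 ≤ q) {j k l : ℕ} (hj : 2 ≤ j) (hjk : j < k) (hkl : k < l) (hlq : l + 1 ≤ q) :
    ∀ t : SumTree,
    treeBR q t {0, -((j : ℤ) - 1), -((k : ℤ) - 1), -((l : ℤ) - 1)} ≤
      (1 - unitRoundoff q) * treeBR q t {0, -(j : ℤ), -(k : ℤ), -(l : ℤ)} +
        (1 + unitRoundoff q) * (2 : ℚ) ^ (-(j : ℤ)) * treeBR q t {0, -((k : ℤ) - j), -((l : ℤ) - j), -((q : ℤ) - j)} := by
  have hq1 : 1 ≤ q := by omega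
  have hq4 : 4 ≤ q := by omega
  obtain ⟨c, hc⟩ : ∃ c : ℕ, (c : ℤ) = (q : ℤ) - k := ⟨q - k, by omega⟩
  obtain ⟨d, hd⟩ : ∃ d : ℕ, (d : ℤ) = (q : ℤ) - j := ⟨q - j, by omega⟩
  obtain ⟨dl, hdl⟩ : ∃ dl : ℕ, (dl : ℤ) = (q : ℤ) - l := ⟨q - l, by omega⟩
  obtain ⟨s, hs⟩ : ∃ s : ℕ, (s : ℤ) = (l : ℤ) - k := ⟨l - k, by omega⟩
  obtain ⟨kj, hkj⟩ : ∃ kj : ℕ, (kj : ℤ) = (k : ℤ) - j := ⟨k - j, by omega⟩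
  obtain ⟨lj, hlj⟩ : ∃ lj : ℕ, (lj : ℤ) = (l : ℤ) - j := ⟨l - j, by omega⟩
  rw [← hkj, ← hlj, ← hd]
  set u := unitRoundoff q with hudef
  set m : ℚ := (2 : ℚ) ^ (-(k : ℤ)) with hmdef
  set ml : ℚ := (2 : ℚ) ^ (-(l : ℤ)) with hmldef
  set t : ℚ := (2 : ℚ) ^ (-(j : ℤ)) with htdef
  ------------------------------------------------------------------ scalar facts
  have huz : u = (2 : ℚ) ^ (-(q : ℤ)) := unitRoundoff_eq_zpow q
  have hu0 : 0 < u := by rw [huz]; exact zpow_pos (by norm_num) _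
  have hm0 : 0 < m := zpow_pos (by norm_num) _
  have hml0 : 0 < ml := zpow_pos (by norm_num) _
  have ht0 : 0 < t := zpow_pos (by norm_num) _
  have two_mul_zpow : ∀ e : ℤ, (2 : ℚ) * (2 : ℚ) ^ e = (2 : ℚ) ^ (e + 1) := fun e => by
    rw [zpow_add_one₀ (by norm_num)]; ring
  have hmu : 2 * u ≤ m := by
    rw [huz, hmdef, two_mul_zpow]; exact zpow_le_zpow_right₀ (by norm_num) (by omega)
  have htm : 2 * m ≤ t := by
    rw [htdef, hmdef, two_mul_zpow]; exact zpow_le_zpow_right₀ (by norm_num) (by omega)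
  have hmlu : 2 * u ≤ ml := by
    rw [huz, hmldef, two_mul_zpow]; exact zpow_le_zpow_right₀ (by norm_num) (by omega)
  have html : 2 * ml ≤ t := by
    rw [htdef, hmldef, two_mul_zpow]; exact zpow_le_zpow_right₀ (by norm_num) (by omega)
  have ht4 : t ≤ 1 / 4 := by
    rw [htdef]
    have : (2 : ℚ) ^ (-(j : ℤ)) ≤ (2 : ℚ) ^ (-2 : ℤ) := zpow_le_zpow_right₀ (by norm_num) (by omega)
    have e : (2 : ℚ) ^ (-2 : ℤ) = 1 / 4 := by norm_num
    rwa [e] at this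
  have hu1 : u ≤ 1 := unitRoundoff_le_one q
  have h2m : (2 : ℚ) ^ (-(((k - 1 : ℕ) : ℤ))) = 2 * m := by rw [hmdef, two_mul_zpow]; congr 1; omega
  have h2ml : (2 : ℚ) ^ (-(((l - 1 : ℕ) : ℤ))) = 2 * ml := by rw [hmldef, two_mul_zpow]; congr 1; omega
  have h2t : (2 : ℚ) ^ (-(((j - 1 : ℕ) : ℤ))) = 2 * t := by rw [htdef, two_mul_zpow]; congr 1; omega
  ------------------------------------------------------------------ per-child rows
  have n0 : ∀ (X : SumTree) (S : Finset ℤ), 0 ≤ treeBR q X S := fun X S => treeBR_nonneg q X S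
  have rsub : ∀ (X : SumTree) (P S : Finset ℤ), P ⊆ S → Routable q S →
      0 ≤ (-1) * treeBR q X P + (1) * treeBR q X S := by
    intro X P S hPS hS
    have h := treeBR_le_of_subset hq1 X hPS hS
    linarith only [h]
  have r4 : Routable q ({0, -(kj : ℤ), -(lj : ℤ), -(d : ℤ)} : Finset ℤ) := by
    intro x hx y hy
    simp only [Finset.mem_insert, Finset.mem_singleton] at hx hy
    rcases hx with rfl | rfl | rfl | rfl <;> rcases hy with rfl | rfl | rfl | rfl <;> omega
  have r3 : ∀ (a b : ℕ), a < b → b + 1 ≤ q → Routable q ({0, -(a : ℤ), -(b : ℤ)} : Finset ℤ) := by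
    intro a b hab hbq x hx y hy
    simp only [Finset.mem_insert, Finset.mem_singleton] at hx hy
    rcases hx with rfl | rfl | rfl <;> rcases hy with rfl | rfl | rfl <;> omega
  have rowM0j : ∀ X : SumTree, 0 ≤ (-1) * treeBR q X {0} + (1) * treeBR q X {0, -(j : ℤ)} := fun X =>
    rsub X _ _ (by intro z hz; rw [Finset.mem_singleton] at hz; simp [hz]) (routable_zero_pair (by omega) (by omega))
  have rowM0cj : ∀ X : SumTree, 0 ≤ (-1) * treeBR q X {0} + (1) * treeBR q X {0, -((c : ℤ) + j)} := fun X =>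
    rsub X _ _ (by intro z hz; rw [Finset.mem_singleton] at hz; simp [hz]) (routable_zero_pair (by omega) (by omega))
  have rowM0dlj : ∀ X : SumTree, 0 ≤ (-1) * treeBR q X {0} + (1) * treeBR q X {0, -((dl : ℤ) + j)} := fun X =>
    rsub X _ _ (by intro z hz; rw [Finset.mem_singleton] at hz; simp [hz]) (routable_zero_pair (by omega) (by omega))
  have rowMs : ∀ X : SumTree, 0 ≤ (-1) * treeBR q X {0, -(s : ℤ)} + (1) * treeBR q X {0, -(s : ℤ), -((c : ℤ) + j)} := fun X =>
    rsub X _ _ (by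
      intro z hz; simp only [Finset.mem_insert, Finset.mem_singleton] at hz ⊢
      rcases hz with h | h
      · exact Or.inl h
      · exact Or.inr (Or.inl h)) (r3 s (c + j) (by omega) (by omega))
  have rowMkl : ∀ X : SumTree, 0 ≤ (-1) * treeBR q X {0, -(kj : ℤ), -(lj : ℤ)} + (1) * treeBR q X {0, -(kj : ℤ), -(lj : ℤ), -(d : ℤ)} := fun X =>
    rsub X _ _ (by
      intro z hz; simp only [Finset.mem_insert, Finset.mem_singleton] at hz ⊢
      rcases hz with h | h | h
      · exact Or.inl h
      · exact Or.inr (Or.inl h)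
      · exact Or.inr (Or.inr (Or.inl h))) r4
  have rowMC : ∀ (X : SumTree) (i : ℕ), 1 ≤ i → i + 2 ≤ q →
      0 ≤ (-2) * treeBR q X {0, -((i : ℤ) + 1)} + (1) * treeBR q X {0, -(i : ℤ)} + (1) * treeBR q X {0} := by
    intro X i hi hiq
    have h := two_treeBR_pair_le (q := q) X (e := -((i : ℤ) + 1)) (by omega) (by omega)
    rw [show -((i : ℤ) + 1) + 1 = -(i : ℤ) by ring] at h
    linarith only [h]
  have rowMC2 : ∀ (X : SumTree) (a i : ℕ), 1 ≤ a → a + 1 ≤ i → i + 2 ≤ q →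
      0 ≤ (-2) * treeBR q X {0, -(a : ℤ), -((i : ℤ) + 1)} + (1) * treeBR q X {0, -(a : ℤ), -(i : ℤ)} +
        (1) * treeBR q X {0, -(a : ℤ)} := by
    intro X a i ha hai hiq
    have h := two_treeBR_triple_le (q := q) X (s := a) (i := i + 1) ha (by omega) (by omega)
    have e1 : ({0, -(a : ℤ), -((i + 1 : ℕ) : ℤ)} : Finset ℤ) = {0, -(a : ℤ), -((i : ℤ) + 1)} := by push_cast; rfl
    have e2 : ({0, -(a : ℤ), -(((i + 1 : ℕ) : ℤ) - 1)} : Finset ℤ) = {0, -(a : ℤ), -(i : ℤ)} := by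
      ext z; simp only [Finset.mem_insert, Finset.mem_singleton]; omega
    rw [e1, e2] at h
    linarith only [h]
  have rowMC3 : ∀ X : SumTree, 0 ≤ (-2) * treeBR q X {0, -(kj : ℤ), -(lj : ℤ), -((d : ℤ) + 1)} +
      (1) * treeBR q X {0, -(kj : ℤ), -(lj : ℤ), -(d : ℤ)} + (1) * treeBR q X {0, -(kj : ℤ), -(lj : ℤ)} := by
    intro X
    have h := two_treeBR_quad_le (q := q) X (a := kj) (b := lj) (i := d + 1) (by omega) (by omega) (by omega) (by omega)
    have e1 : ({0, -(kj : ℤ), -(lj : ℤ), -((d + 1 : ℕ) : ℤ)} : Finset ℤ) = {0, -(kj : ℤ), -(lj : ℤ), -((d : ℤ) + 1)} := by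
      push_cast; rfl
    have e2 : ({0, -(kj : ℤ), -(lj : ℤ), -(((d + 1 : ℕ) : ℤ) - 1)} : Finset ℤ) = {0, -(kj : ℤ), -(lj : ℤ), -(d : ℤ)} := by
      ext z; simp only [Finset.mem_insert, Finset.mem_singleton]; omega
    rw [e1, e2] at h
    linarith only [h]
  have rowGC : ∀ (X : SumTree) (i : ℕ), 1 ≤ i → i + j + 1 ≤ q →
      0 ≤ (-2*u + 2*u*t) * treeBR q X {0, -((i : ℤ) + 1)} + (u) * treeBR q X {0, -((i : ℤ) + j)} +
        (u - 2*u*t) * treeBR q X {0, -(i : ℤ)} := by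
    intro X i hi hiq
    have h := treeBR_gcB1_pair (q := q) X (i := i) (n := j) hi hj hiq
    rw [← htdef] at h
    have h' := mul_le_mul_of_nonneg_left h hu0.le
    rw [mul_zero] at h'
    linarith only [h']
  have rowGC2 : ∀ X : SumTree, 0 ≤ (-2*u + 2*u*t) * treeBR q X {0, -(s : ℤ), -((c : ℤ) + 1)} +
      (u) * treeBR q X {0, -(s : ℤ), -((c : ℤ) + j)} + (u - 2*u*t) * treeBR q X {0, -(s : ℤ), -(c : ℤ)} := by
    intro X
    have h := treeBR_gcB1_triple (q := q) X (s := s) (i := c) (n := j) (by omega) (by omega) hj (by omega)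
    rw [← htdef] at h
    have h' := mul_le_mul_of_nonneg_left h hu0.le
    rw [mul_zero] at h'
    linarith only [h']
  have rowR31 : ∀ X : SumTree, 0 ≤ (-1) * treeBR q X {0, -((j : ℤ) - 1)} + (1 - u) * treeBR q X {0, -(j : ℤ)} +
      (t + u*t) * treeBR q X {0, -(d : ℤ)} := by
    intro X
    have h := treeBR_twoFam_le (by omega : 3 ≤ q) (j := j) hj (by omega) X
    have e1 : treeBR q X {-1, -(j : ℤ)} = (2 : ℚ) ^ (-1 : ℤ) * treeBR q X {0, -((j : ℤ) - 1)} := by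
      rw [← treeBR_pair_shift X (-1) (-((j : ℤ) - 1))]; congr 1; ext z; simp; omega
    have e2 : treeBR q X {-(j : ℤ), -(q : ℤ)} = t * treeBR q X {0, -(d : ℤ)} := by
      rw [htdef, ← treeBR_pair_shift X (-(j : ℤ)) (-(d : ℤ))]; congr 1; ext z; simp; omega
    rw [e1, e2, ← hudef] at h
    have e3 : 2 * ((2 : ℚ) ^ (-1 : ℤ) * treeBR q X {0, -((j : ℤ) - 1)}) = treeBR q X {0, -((j : ℤ) - 1)} := by
      rw [← mul_assoc, show (2 : ℚ) * (2 : ℚ) ^ (-1 : ℤ) = 1 by norm_num, one_mul]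
    rw [e3] at h
    linarith only [h]
  have rowPhi3jk : ∀ X : SumTree, 0 ≤ (-1) * treeBR q X {0, -((k : ℤ) - 1)} + (1 - u) * treeBR q X {0, -(k : ℤ)} +
      (m) * treeBR q X {0, -(c : ℤ), -((c : ℤ) + j)} + (u*m) * treeBR q X {0, -((c : ℤ) + j)} := by
    intro X
    have h := treeBR_phi3 hq4 hj hjk (by omega) X
    rw [← hc, ← hudef, ← hmdef] at h
    linarith only [h]
  have rowPhi3jl : ∀ X : SumTree, 0 ≤ (-1) * treeBR q X {0, -((l : ℤ) - 1)} + (1 - u) * treeBR q X {0, -(l : ℤ)} +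
      (ml) * treeBR q X {0, -(dl : ℤ), -((dl : ℤ) + j)} + (u*ml) * treeBR q X {0, -((dl : ℤ) + j)} := by
    intro X
    have h := treeBR_phi3 hq4 (j := j) (k := l) hj (by omega) hlq X
    rw [← hdl, ← hudef, ← hmldef] at h
    linarith only [h]
  have rowE2jk : ∀ X : SumTree, 0 ≤ (-1) * treeBR q X {0, -((j : ℤ) - 1), -((k : ℤ) - 1)} + (1 - u) * treeBR q X {0, -(j : ℤ), -(k : ℤ)} +
      (t + u*t) * treeBR q X {0, -(kj : ℤ), -(d : ℤ)} := by
    intro X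
    have h := treeBR_eRow2 hq4 hj hjk (by omega) X
    rw [← hkj, ← hd, ← hudef, ← htdef] at h
    linarith only [h]
  have rowE2jl : ∀ X : SumTree, 0 ≤ (-1) * treeBR q X {0, -((j : ℤ) - 1), -((l : ℤ) - 1)} + (1 - u) * treeBR q X {0, -(j : ℤ), -(l : ℤ)} +
      (t + u*t) * treeBR q X {0, -(lj : ℤ), -(d : ℤ)} := by
    intro X
    have h := treeBR_eRow2 hq4 (j := j) (k := l) hj (by omega) hlq X
    rw [← hlj, ← hd, ← hudef, ← htdef] at h
    linarith only [h]
  have rowPhi3p : ∀ X : SumTree, 0 ≤ (-1) * treeBR q X {0, -((k : ℤ) - 1), -((l : ℤ) - 1)} + (1 - u) * treeBR q X {0, -(k : ℤ), -(l : ℤ)} +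
      (m) * treeBR q X {0, -(s : ℤ), -(c : ℤ), -((c : ℤ) + j)} + (u*m) * treeBR q X {0, -(s : ℤ), -((c : ℤ) + j)} := by
    intro X
    have h := treeBR_phi3p hq hj hjk hkl hlq X
    rw [← hs, ← hc, ← hudef, ← hmdef] at h
    linarith only [h]
  -- symmetry of the node
  have comm : ∀ (A B : SumTree) (S : Finset ℤ), treeBR q (.node B A) S = treeBR q (.node A B) S :=
    fun A B S => by unfold treeBR; exact treeBRw_node_comm q _ B A S
  ------------------------------------------------------------------ the induction
  intro tr
  induction tr with
  | leaf z => simp [treeBR]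
  | node A B ihA ihB =>
    set NJ := treeBR q (.node A B) {0, -(j : ℤ), -(k : ℤ), -(l : ℤ)} with hNJ
    set NR := treeBR q (.node A B) {0, -(kj : ℤ), -(lj : ℤ), -(d : ℤ)} with hNR
    -- the right-hand options (both orientations)
    obtain ⟨oJ1ab, oJ2ab, oJ3ab, oJ4ab, oJ5ab, oJ6ab, oJ7ab, oJ8ab⟩ :=
      e3_optJKL (q := q) hq1 (by omega) hjk hkl hlq hc hd hdl hs hkj hlj A B
    obtain ⟨oJ1ba, oJ2ba, oJ3ba, oJ4ba, oJ5ba, oJ6ba, oJ7ba, oJ8ba⟩ :=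
      e3_optJKL (q := q) hq1 (by omega) hjk hkl hlq hc hd hdl hs hkj hlj B A
    obtain ⟨oR1ab, oR2ab, oR3ab, oR4ab, oR5ab, oR6ab, oR7ab, oR8ab⟩ :=
      e3_optR (q := q) hq1 (by omega) hjk hkl hlq hc hd hdl hs hkj hlj A B
    obtain ⟨oR1ba, oR2ba, oR3ba, oR4ba, oR5ba, oR6ba, oR7ba, oR8ba⟩ :=
      e3_optR (q := q) hq1 (by omega) hjk hkl hlq hc hd hdl hs hkj hlj B A
    simp only [← huz, ← hmdef, ← hmldef, ← htdef] at oJ1ab oJ2ab oJ3ab oJ4ab oJ5ab oJ6ab oJ7ab oJ8ab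
    simp only [← huz, ← hmdef, ← hmldef, ← htdef] at oJ1ba oJ2ba oJ3ba oJ4ba oJ5ba oJ6ba oJ7ba oJ8ba
    simp only [← huz, ← hmdef, ← hmldef, ← htdef] at oR1ab oR2ab oR3ab oR4ab oR5ab oR6ab oR7ab oR8ab
    simp only [← huz, ← hmdef, ← hmldef, ← htdef] at oR1ba oR2ba oR3ba oR4ba oR5ba oR6ba oR7ba oR8ba
    rw [comm] at oJ1ba oJ2ba oJ3ba oJ4ba oJ5ba oJ6ba oJ7ba oJ8ba oR1ba oR2ba oR3ba oR4ba oR5ba oR6ba oR7ba oR8ba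
    -- in the `(1) * X + (w) * Y` shapes of the branch lemmas
    have sh1 : ∀ {X Y w N : ℚ}, 1 + (X + w * Y) ≤ N → 1 + ((1) * X + (w) * Y) ≤ N := by
      intro X Y w N h; linarith only [h]
    have sht : ∀ {X Y w N : ℚ}, t + (t * X + w * Y) ≤ t * N → (t) + ((t) * X + (w) * Y) ≤ (t) * N := by
      intro X Y w N h; linarith only [h]
    -- induction hypotheses as rows
    have ihA' : 0 ≤ (-1) * treeBR q A {0, -((j : ℤ) - 1), -((k : ℤ) - 1), -((l : ℤ) - 1)} +
        (1 - u) * treeBR q A {0, -(j : ℤ), -(k : ℤ), -(l : ℤ)} + (t + u*t) * treeBR q A {0, -(kj : ℤ), -(lj : ℤ), -(d : ℤ)} := by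
      linarith only [ihA]
    have ihB' : 0 ≤ (-1) * treeBR q B {0, -((j : ℤ) - 1), -((k : ℤ) - 1), -((l : ℤ) - 1)} +
        (1 - u) * treeBR q B {0, -(j : ℤ), -(k : ℤ), -(l : ℤ)} + (t + u*t) * treeBR q B {0, -(kj : ℤ), -(lj : ℤ), -(d : ℤ)} := by
      linarith only [ihB]
    -- R ≥ 0
    have hRHS : (1 - u) * NJ + (t + u*t) * NR = (1 - u) * NJ + (1 + u) * t * NR := by ring
    have hR : 0 ≤ (1 - u) * NJ + (1 + u) * t * NR - 1 := by
      have h1 : 1 ≤ NJ := by linarith only [oJ1ab, n0 A {0, -(j : ℤ), -(k : ℤ), -(l : ℤ)}, mul_nonneg hu0.le (n0 B {0})]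
      have h2 : 1 ≤ NR := by linarith only [oR1ab, n0 A {0, -(kj : ℤ), -(lj : ℤ), -(d : ℤ)}, mul_nonneg hu0.le (n0 B {0})]
      have h4 := mul_le_mul_of_nonneg_left h1 (by linarith only [hu1] : (0 : ℚ) ≤ 1 - u)
      have h5 := mul_le_mul_of_nonneg_left h2 (by positivity : (0 : ℚ) ≤ (1 + u) * t)
      linarith only [h4, h5, hmu, htm, hu0, mul_nonneg hu0.le ht0.le]
    -- the sixteen branches
    have bAll : ∀ {X Y : SumTree} {NJ' NR' : ℚ},
        1 + (treeBR q X {0, -(j : ℤ), -(k : ℤ), -(l : ℤ)} + u * treeBR q Y {0}) ≤ NJ' →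
        1 + (treeBR q X {0, -(kj : ℤ), -(lj : ℤ), -(d : ℤ)} + u * treeBR q Y {0}) ≤ NR' →
        0 ≤ (-1) * treeBR q X {0, -((j : ℤ) - 1), -((k : ℤ) - 1), -((l : ℤ) - 1)} +
          (1 - u) * treeBR q X {0, -(j : ℤ), -(k : ℤ), -(l : ℤ)} + (t + u*t) * treeBR q X {0, -(kj : ℤ), -(lj : ℤ), -(d : ℤ)} →
        1 + (treeBR q X {0, -((j : ℤ) - 1), -((k : ℤ) - 1), -((l : ℤ) - 1)} + u * treeBR q Y {0}) ≤ (1 - u) * NJ' + (t + u*t) * NR' :=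
      fun o1 o2 ih => eRow2_branch4 hu0 hmu htm ht4 (sh1 o1) (sh1 o2) ih (n0 _ _)
    have key := treeBR_quad_node_le hq1 A B (a := j - 1) (b := k - 1) (e := l - 1) (by omega) (by omega) (by omega) (by omega) hR ?_
    · have ea : -(((j - 1 : ℕ) : ℤ)) = -((j : ℤ) - 1) := by omega
      have eb : -(((k - 1 : ℕ) : ℤ)) = -((k : ℤ) - 1) := by omega
      have ee : -(((l - 1 : ℕ) : ℤ)) = -((l : ℤ) - 1) := by omega
      rw [ea, eb, ee] at key
      linarith only [key]
    intro X Y hXY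
    -- offsets of the complements
    have f1 : (q : ℤ) - ((l - 1 : ℕ) : ℤ) = (dl : ℤ) + 1 := by omega
    have f2 : (q : ℤ) - ((k - 1 : ℕ) : ℤ) = (c : ℤ) + 1 := by omega
    have f3 : (q : ℤ) - ((j - 1 : ℕ) : ℤ) = (d : ℤ) + 1 := by omega
    have f4 : (((l - 1 : ℕ) : ℤ)) - ((k - 1 : ℕ) : ℤ) = (s : ℤ) := by omega
    have f5 : (((l - 1 : ℕ) : ℤ)) - ((j - 1 : ℕ) : ℤ) = (lj : ℤ) := by omega
    have f6 : (((k - 1 : ℕ) : ℤ)) - ((j - 1 : ℕ) : ℤ) = (kj : ℤ) := by omega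
    have ea : -(((j - 1 : ℕ) : ℤ)) = -((j : ℤ) - 1) := by omega
    have eb : -(((k - 1 : ℕ) : ℤ)) = -((k : ℤ) - 1) := by omega
    have ee : -(((l - 1 : ℕ) : ℤ)) = -((l : ℤ) - 1) := by omega
    rw [f1, f2, f3, f4, f5, f6, h2m, h2ml, h2t, ← huz]
    simp only [ea, eb, ee]
    rcases hXY with ⟨rfl, rfl⟩ | ⟨rfl, rfl⟩
    · refine ⟨?_, ?_, ?_, ?_, ?_, ?_, ?_, ?_⟩
      · have b := bAll oJ1ab oR1ab ihA'
        linarith only [b, hRHS]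
      · have b := eRow2_branch2 hu0 hmlu html ht4 (sh1 oJ2ab) (sht oR3ab) (rowE2jk X) (rowMC Y dl (by omega) (by omega))
          (rowGC Y dl (by omega) (by omega)) (rowM0dlj Y)
        linarith only [b, hRHS]
      · have b := eRow2_branch2 hu0 hmu htm ht4 (sh1 oJ3ab) (sht oR4ab) (rowE2jl X) (rowMC Y c (by omega) (by omega))
          (rowGC Y c (by omega) (by omega)) (rowM0cj Y)
        linarith only [b, hRHS]
      · have b := eRow2_branch3 hu0 hmu htm ht4 (sh1 oJ4ab) (sht oR8ba) (sht oR7ba) (rowPhi3p X) (rowMC Y d (by omega) (by omega))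
        linarith only [b, hRHS]
      · have b := eRow2_branch2 hu0 hmu htm ht4 (sh1 oJ5ab) (sht oR7ab) (rowR31 X) (rowMC2 Y s c (by omega) (by omega) (by omega))
          (rowGC2 Y) (rowMs Y)
        linarith only [b, hRHS]
      · have b := eRow2_branch3 hu0 hmu htm ht4 (sh1 oJ6ab) (sht oR6ba) (sht oR4ba) (rowPhi3jk X) (rowMC2 Y lj d (by omega) (by omega) (by omega))
        linarith only [b, hRHS]
      · have b := eRow2_branch3 hu0 hmlu html ht4 (sh1 oJ7ab) (sht oR5ba) (sht oR3ba) (rowPhi3jl X) (rowMC2 Y kj d (by omega) (by omega) (by omega))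
        linarith only [b, hRHS]
      · have b := eRow2_branch1 hu0 hmu htm ht4 (sh1 oJ8ab) (sht oR2ba) (sh1 oR1ba) (rowM0j X) (rowMC3 Y) (rowMkl Y)
        linarith only [b, hRHS]
    · refine ⟨?_, ?_, ?_, ?_, ?_, ?_, ?_, ?_⟩
      · have b := bAll oJ1ba oR1ba ihB'
        linarith only [b, hRHS]
      · have b := eRow2_branch2 hu0 hmlu html ht4 (sh1 oJ2ba) (sht oR3ba) (rowE2jk X) (rowMC Y dl (by omega) (by omega))
          (rowGC Y dl (by omega) (by omega)) (rowM0dlj Y)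
        linarith only [b, hRHS]
      · have b := eRow2_branch2 hu0 hmu htm ht4 (sh1 oJ3ba) (sht oR4ba) (rowE2jl X) (rowMC Y c (by omega) (by omega))
          (rowGC Y c (by omega) (by omega)) (rowM0cj Y)
        linarith only [b, hRHS]
      · have b := eRow2_branch3 hu0 hmu htm ht4 (sh1 oJ4ba) (sht oR8ab) (sht oR7ab) (rowPhi3p X) (rowMC Y d (by omega) (by omega))
        linarith only [b, hRHS]
      · have b := eRow2_branch2 hu0 hmu htm ht4 (sh1 oJ5ba) (sht oR7ba) (rowR31 X) (rowMC2 Y s c (by omega) (by omega) (by omega))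
          (rowGC2 Y) (rowMs Y)
        linarith only [b, hRHS]
      · have b := eRow2_branch3 hu0 hmu htm ht4 (sh1 oJ6ba) (sht oR6ab) (sht oR4ab) (rowPhi3jk X) (rowMC2 Y lj d (by omega) (by omega) (by omega))
        linarith only [b, hRHS]
      · have b := eRow2_branch3 hu0 hmlu html ht4 (sh1 oJ7ba) (sht oR5ab) (sht oR3ab) (rowPhi3jl X) (rowMC2 Y kj d (by omega) (by omega) (by omega))
        linarith only [b, hRHS]
      · have b := eRow2_branch1 hu0 hmu htm ht4 (sh1 oJ8ba) (sht oR2ab) (sh1 oR1ab) (rowM0j X) (rowMC3 Y) (rowMkl Y)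
        linarith only [b, hRHS]

end E3

end Summit.Ventures.CertifiedArithmetic.LowPrec.Opt
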